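import Mathlib
import Literature.Combinatorics.Optimization.LpFormulationReductions
import HarnessLib

/-!
# From matrix approximation to problem approximations (Braun–Pokutta–Zink 2015, §7)

G. Braun, S. Pokutta, D. Zink, *Inapproximability of combinatorial problems via small LPs and SDPs*, STOC 2015
[BraunPokuttaZink2015] (held `paper:arxiv-1410.8816`, §7 "From matrix approximation to problem approximations",
p. 23–24): "a nonnegative matrix with small nonnegative rank (or semidefinite rank) that is close to a slack matrix of a
problem `𝒫` of interest can be rounded to an actual slack matrix with a moderate increase in nonnegative rank (or
semidefinite rank) and error. This argument is implicitly contained in [Rothvoss11, BDP2013] …".  PROVED here (no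
named facts), over the tree's Braun–Pokutta–Zink vocabulary (`MaxProblem`, `MaxProblem.slackMatrix`,
`HasNonnegFactorization`, `HasPsdFactorization`, `LPFormulation`, `SDPFormulation`):

* **Lemma 7.1** (`BraunPokuttaZink2015_lemma71`, rows form `exists_rows_coeff_abs_le_one`): "Let `M ∈ ℝ^{m×n}` be a
  real matrix of rank `r`. Then there are column vectors `a_1,…,a_r ∈ ℝ^m` and row vectors `b_1,…,b_r ∈ ℝ^n` with
  `M = Σ_{i∈[r]} a_i b_i`. Moreover, `‖a_i‖_∞ ≤ 1` and `‖b_i‖_∞ ≤ ‖M‖_∞`."  The printed proof picks `r` rows of maximal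
  volume in `⋀^r` of the row space; here the same maximisation is done on the determinant of the coordinate matrix of an
  `r`-tuple of rows with respect to a basis of the row space extracted from the rows (`exists_linearIndependent`,
  `Module.Basis.mk`), the coefficients are given by Cramer's rule (`Matrix.cramer_transpose_apply`: ratios of volumes,
  hence `≤ 1` by maximality), and `b_j = M_{i_j}` are rows of `M` (so `‖b_j‖_∞ ≤ ‖M‖_∞`, typed against any entrywise
  bound `C`).  `r = rank M` via `Matrix.rank_eq_finrank_span_row`.
* **Theorem 7.2** (maximization case; `MaxProblem.shiftC P δ` is the problem with the "adjusted guarantee"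
  `C'(f) = C(f) + δ`): "for `C'(f) := C(f) + (rank M + rank M̃)‖M̃ − M‖_∞` … `fc(𝒫, C', S) ≤ rk_LP M̃ + 2(rank M + rank M̃)`
  and `fc_SDP(𝒫, C', S) ≤ rk_SDP M̃ + 2(rank M + rank M̃)`."  Typed in factorization currency with any `k ≥ rank(M̃ − M)`
  (the printed `k = rank M + rank M̃` qualifies: `rank_sub_slackMatrix_le`) and any `η ≥ ‖M̃ − M‖_∞`:
  `BraunPokuttaZink2015_thm72_lp` — a nonnegative factorization of `M̃` of size `r` yields one of the `(C + kη, S)`-slack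
  matrix of size `r + 2k + 1`; `BraunPokuttaZink2015_thm72_sdp` — the same for psd factorizations; at formulation
  level `nonempty_lpFormulation_shiftC` / `nonempty_sdpFormulation_shiftC` (via the tree's factorization theorems
  `LPFormulation.nonempty_of_hasNonnegFactorization`, `SDPFormulation.nonempty_of_hasPsdFactorization`).  Proof as
  printed: Lemma 7.1 on `M̃ − M = Σ_i a_i b_i` and the vector identity
  `Σ|a_i| b − Σ a_i b_i = Σ a_i⁺(b − b_i) + Σ a_i⁻(b + b_i)` with `b = η𝟙`, giving
  `M + kη𝟙 = M̃ + Σ_i a_i⁺(η𝟙 − b_i) + Σ_i a_i⁻(η𝟙 + b_i) + (Σ_i (1 − |a_i|) + (k − rank(M̃−M)))·η𝟙`, all correction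
  terms nonnegative of rank one (`correction_terms`).

Recorded bookkeeping (not repairs): the "+1" relative to the printed `2(rank M + rank M̃)` is the tree's currency
(`HasNonnegFactorization`/`HasPsdFactorization` have no free affine term; `fc ≤ rank ≤ fc + 1`, cf. BPR16 Remark 2.19 in
`SdpFormulationReductions.lean`), the last rank-one summand being exactly such an affine (row-constant) term; the
minimization case (`C' = C − …`) is not typed (the tree's `MaxProblem` is maximization only); `M̃ ≥ 0` is implied by
its nonnegative / psd factorization and not assumed separately.
-/

noncomputable section

open Finset Matrix
open scoped Classical

namespace Literature.Combinatorics.Optimization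

/-! ### Lemma 7.1: factorization through a maximal-volume set of rows -/

section Lemma71

variable {m n : Type*} [Fintype m] [Fintype n]

/-- **Lemma 7.1, rows form.**  Every real matrix of rank `r` has `r` rows `M_{i_1}, …, M_{i_r}` through which all
rows factor with coefficients of absolute value at most `1`: `M_k = Σ_j a_{k,j} M_{i_j}`, `|a_{k,j}| ≤ 1` (choose the
`r` rows of maximal volume in `⋀^r` of the row space; the coefficients are ratios of volumes).
[cite: BraunPokuttaZink2015, Lemma 7.1 and its proof] -/
theorem exists_rows_coeff_abs_le_one (M : Matrix m n ℝ) :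
    ∃ (r : ℕ) (ρ : Fin r → m) (a : m → Fin r → ℝ),
      r = M.rank ∧ (∀ k, M k = ∑ j, a k j • M (ρ j)) ∧ ∀ k j, |a k j| ≤ 1 := by
  -- the row space `V`, the rows as elements of `V`
  set V : Submodule ℝ (n → ℝ) := Submodule.span ℝ (Set.range M) with hV
  let v : m → V := fun k => ⟨M k, Submodule.subset_span ⟨k, rfl⟩⟩
  have hvspan : Submodule.span ℝ (Set.range v) = ⊤ := by
    have h := (Submodule.span_span_coe_preimage (R := ℝ) (s := Set.range M))
    have hpre : (Subtype.val ⁻¹' Set.range M : Set V) = Set.range v := by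
      ext x
      constructor
      · rintro ⟨k, hk⟩
        exact ⟨k, Subtype.ext hk⟩
      · rintro ⟨k, rfl⟩
        exact ⟨k, rfl⟩
    rwa [hpre] at h
  -- a linearly independent spanning set of rows, as a basis of `V`
  obtain ⟨B, hBsub, hBspan, hBli⟩ := exists_linearIndependent ℝ (Set.range v)
  have hBtop : ⊤ ≤ Submodule.span ℝ (Set.range (Subtype.val : B → V)) := by
    rw [Subtype.range_coe_subtype, Set.setOf_mem_eq, hBspan, hvspan]
  haveI : Finite B := ((Set.finite_range v).subset hBsub).to_subtype
  letI : Fintype B := Fintype.ofFinite B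
  let e₀ : Module.Basis B ℝ V := Module.Basis.mk hBli hBtop
  set r := Fintype.card B with hr
  let σ : B ≃ Fin r := Fintype.equivFin B
  let e : Module.Basis (Fin r) ℝ V := e₀.reindex σ
  -- every basis vector is a row
  have hmem : ∀ j : Fin r, ∃ k : m, v k = e j := by
    intro j
    have hej : (e j : V) = ((σ.symm j : B) : V) := by
      simp only [e, e₀, Module.Basis.reindex_apply, Module.Basis.mk_apply]
    obtain ⟨k, hk⟩ := hBsub (σ.symm j).2
    exact ⟨k, by rw [hej]; exact hk⟩
  choose τ₁ hτ₁ using hmem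
  -- coordinates; the volume of an `r`-tuple of rows
  let c : m → Fin r → ℝ := fun k => e.equivFun (v k)
  let A : (Fin r → m) → Matrix (Fin r) (Fin r) ℝ := fun τ => Matrix.of fun i j => c (τ i) j
  have hA1 : A τ₁ = 1 := by
    ext i j
    simp only [A, c, Matrix.of_apply, hτ₁, Module.Basis.equivFun_self, Matrix.one_apply]
  haveI : Nonempty (Fin r → m) := ⟨τ₁⟩
  obtain ⟨τ₀, hτ₀⟩ := Finite.exists_max fun τ : Fin r → m => |(A τ).det|
  have hD0 : (A τ₀).det ≠ 0 := by
    intro h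
    have h1 := hτ₀ τ₁
    rw [h, abs_zero, hA1, det_one, abs_one] at h1
    linarith
  -- the coefficients, by Cramer's rule
  let a : m → Fin r → ℝ := fun k i => ((A τ₀).det)⁻¹ * (A τ₀)ᵀ.cramer (c k) i
  refine ⟨r, τ₀, a, ?_, fun k => ?_, fun k j => ?_⟩
  · -- `r = rank M`
    rw [Matrix.rank_eq_finrank_span_row]
    change r = Module.finrank ℝ V
    rw [Module.finrank_eq_card_basis e, Fintype.card_fin]
  · -- the identity `M_k = Σ_j a_{k,j} M_{τ₀ j}`
    have hcr := Matrix.mulVec_cramer (A τ₀)ᵀ (c k)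
    rw [det_transpose] at hcr
    have hcoord : e.equivFun (∑ j, a k j • v (τ₀ j)) = c k := by
      funext l
      have hl := congrFun hcr l
      simp only [Matrix.mulVec, dotProduct, Matrix.transpose_apply, Pi.smul_apply, smul_eq_mul, A,
        Matrix.of_apply] at hl
      rw [map_sum]
      simp only [map_smul, Finset.sum_apply, Pi.smul_apply, smul_eq_mul]
      calc ∑ j, a k j * e.equivFun (v (τ₀ j)) l
          = ((A τ₀).det)⁻¹ * ∑ j, c (τ₀ j) l * (A τ₀)ᵀ.cramer (c k) j := by
            rw [mul_sum]
            exact sum_congr rfl fun j _ => by simp only [a, c]; ring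
        _ = c k l := by rw [hl, ← mul_assoc, inv_mul_cancel₀ hD0, one_mul]
    have hv : ∑ j, a k j • v (τ₀ j) = v k := e.equivFun.injective hcoord
    have hval := congrArg Subtype.val hv
    simp only [Submodule.coe_sum, Submodule.coe_smul, v] at hval
    exact hval.symm
  · -- `|a_{k,j}| ≤ 1` by maximality of the volume
    have hupd : (A τ₀).updateRow j (c k) = A (Function.update τ₀ j k) := by
      ext i l
      simp only [A, Matrix.updateRow_apply, Matrix.of_apply, Function.update_apply]
      split_ifs with h <;> rfl
    have h1 := hτ₀ (Function.update τ₀ j k)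
    simp only [a, Matrix.cramer_transpose_apply, hupd, abs_mul, abs_inv]
    rw [inv_mul_le_iff₀ (abs_pos.2 hD0), mul_one]
    exact h1

/-- **Lemma 7.1** (Braun–Pokutta–Zink): "Let `M ∈ ℝ^{m×n}` be a real matrix of rank `r`. Then there are column
vectors `a_1,…,a_r ∈ ℝ^m` and row vectors `b_1,…,b_r ∈ ℝ^n` with `M = Σ_{i∈[r]} a_i b_i`. Moreover `‖a_i‖_∞ ≤ 1` and
`‖b_i‖_∞ ≤ ‖M‖_∞`."  Typed with `‖M‖_∞ ≤ C` as any entrywise bound `C` (the `b_i` are rows of `M`).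
[cite: BraunPokuttaZink2015, Lemma 7.1] -/
theorem BraunPokuttaZink2015_lemma71 (M : Matrix m n ℝ) {C : ℝ} (hC : ∀ k l, |M k l| ≤ C) :
    ∃ (r : ℕ) (a : Fin r → m → ℝ) (b : Fin r → n → ℝ), r = M.rank ∧
      (∀ k l, M k l = ∑ i, a i k * b i l) ∧ (∀ i k, |a i k| ≤ 1) ∧ ∀ i l, |b i l| ≤ C := by
  obtain ⟨r, ρ, a, hr, hM, ha⟩ := exists_rows_coeff_abs_le_one M
  refine ⟨r, fun i k => a k i, fun i => M (ρ i), hr, fun k l => ?_, fun i k => ha k i, fun i l => hC _ _⟩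
  conv_lhs => rw [hM k]
  simp only [Finset.sum_apply, Pi.smul_apply, smul_eq_mul]

end Lemma71

/-! ### Rank of a difference -/

section Rank

variable {m n : Type*} [Fintype n]

/-- `rank(A − B) ≤ rank A + rank B`. [folklore] -/
private theorem rank_sub_le (A B : Matrix m n ℝ) : (A - B).rank ≤ A.rank + B.rank := by
  unfold Matrix.rank
  have hle : (A - B).mulVecLin.range ≤ A.mulVecLin.range ⊔ B.mulVecLin.range := by
    rintro y ⟨x, rfl⟩
    have : (A - B).mulVecLin x = A.mulVecLin x - B.mulVecLin x := by
      simp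
    rw [this]
    exact Submodule.sub_mem _ (Submodule.mem_sup_left ⟨x, rfl⟩) (Submodule.mem_sup_right ⟨x, rfl⟩)
  exact (Submodule.finrank_mono hle).trans (Submodule.finrank_add_le_finrank_add_finrank _ _)

end Rank

/-! ### Theorem 7.2: rounding an approximate slack matrix -/

section Thm72

variable {σ φ : Type*}

/-- The problem with the completeness guarantee shifted by `δ`: `C'(f) = C(f) + δ` (same `val`, same `S`).
[cite: BraunPokuttaZink2015, Thm. 7.2 ("the adjusted guarantee `C'`")] -/
def MaxProblem.shiftC (P : MaxProblem σ φ) (δ : ℝ) : MaxProblem σ φ where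
  val := P.val
  C f := P.C f + δ
  S := P.S

/-- Soundness is unchanged by shifting `C`. [cite: BraunPokuttaZink2015, Thm. 7.2] -/
@[simp] theorem MaxProblem.shiftC_sound (P : MaxProblem σ φ) (δ : ℝ) (f : φ) : (P.shiftC δ).Sound f ↔ P.Sound f :=
  Iff.rfl

/-- The slack matrix of the shifted problem is the old one plus `δ`. [cite: BraunPokuttaZink2015, Thm. 7.2] -/
theorem MaxProblem.shiftC_slackMatrix (P : MaxProblem σ φ) (δ : ℝ) (f : {f : φ // (P.shiftC δ).Sound f}) (s : σ) :
    (P.shiftC δ).slackMatrix f s = P.slackMatrix ⟨f.1, f.2⟩ s + δ := by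
  simp only [MaxProblem.slackMatrix_apply, MaxProblem.shiftC]
  ring

/-- A sum of `k` nonnegative rank-one terms is a nonnegative factorization of size `k`. [folklore] -/
private theorem hasNonnegFactorization_sum {ι κ : Type*} {k : ℕ} (u : Fin k → ι → ℝ) (w : Fin k → κ → ℝ)
    (hu : ∀ i x, 0 ≤ u i x) (hw : ∀ i y, 0 ≤ w i y) :
    HasNonnegFactorization (fun x y => ∑ i, u i x * w i y) k :=
  ⟨fun x i => u i x, fun i y => w i y, fun x i => hu i x, fun i y => hw i y, fun _ _ => rfl⟩

/-- Padding a nonnegative factorization with zero terms. [folklore] -/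
private theorem HasNonnegFactorization.mono' {ι κ : Type*} {M : ι → κ → ℝ} {r s : ℕ}
    (h : HasNonnegFactorization M r) (hrs : r ≤ s) : HasNonnegFactorization M s := by
  have h0 : HasNonnegFactorization (fun (_ : ι) (_ : κ) => (0 : ℝ)) (s - r) :=
    ⟨fun _ _ => 0, fun _ _ => 0, fun _ _ => le_rfl, fun _ _ => le_rfl, fun _ _ => by simp⟩
  have h1 := h.add h0
  rw [Nat.add_sub_cancel' hrs] at h1
  simpa using h1

/-- The vector identity behind Thm. 7.2: `η − a b = a⁺(η − b) + a⁻(η + b) + (1 − |a|) η`.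
[cite: BraunPokuttaZink2015, proof of Thm. 7.2 (eq. (vector identity))] -/
private theorem shift_sub_mul_eq (a b η : ℝ) :
    η - a * b = max a 0 * (η - b) + max (-a) 0 * (η + b) + (1 - |a|) * η := by
  have h1 := max_zero_sub_max_neg_zero_eq_self a
  have h2 := max_zero_add_max_neg_zero_eq_abs_self a
  linear_combination b * h1 - η * h2

variable [Fintype σ] [Fintype φ]

omit [Fintype φ] in
/-- `rank(M̃ − M) ≤ rank M + rank M̃`, the printed choice of `k`. [cite: BraunPokuttaZink2015, Thm. 7.2] -/
theorem rank_sub_slackMatrix_le (P : MaxProblem σ φ) (Mt : {f : φ // P.Sound f} → σ → ℝ) :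
    (Matrix.of fun f s => Mt f s - P.slackMatrix f s).rank ≤
      (Matrix.of fun f s => P.slackMatrix f s).rank + (Matrix.of fun f s => Mt f s).rank := by
  have hsub : (Matrix.of fun f s => Mt f s - P.slackMatrix f s) =
      (Matrix.of fun f s => Mt f s) - Matrix.of fun (f : {f : φ // P.Sound f}) s => P.slackMatrix f s := by
    ext f s; rfl
  rw [hsub, add_comm]
  exact rank_sub_le _ _

omit [Fintype σ] [Fintype φ] in
/-- **The correction terms of Thm. 7.2**: if `M̃ − M = Σ_{i<k₀} a_i b_i` with `‖a_i‖_∞ ≤ 1`, `‖b_i‖_∞ ≤ η`, `η ≥ 0`, and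
`k₀ ≤ k`, then `M' := M + kη𝟙 = M̃ + N` entrywise with `N` of nonnegative rank `≤ 2k₀ + 1`:
`N = Σ_i a_i⁺(η − b_i) + Σ_i a_i⁻(η + b_i) + (Σ_i (1 − |a_i|) + (k − k₀)) η`.
[cite: BraunPokuttaZink2015, proof of Thm. 7.2] -/
private theorem correction_terms (P : MaxProblem σ φ) (Mt : {f : φ // P.Sound f} → σ → ℝ) {η : ℝ}
    (hη0 : 0 ≤ η) {k₀ k : ℕ} (hkk : k₀ ≤ k) (a : Fin k₀ → {f : φ // P.Sound f} → ℝ) (b : Fin k₀ → σ → ℝ)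
    (hEab : ∀ f s, Mt f s - P.slackMatrix f s = ∑ i, a i f * b i s) (ha : ∀ i f, |a i f| ≤ 1)
    (hb : ∀ i s, |b i s| ≤ η) :
    ∃ N : {f : φ // (P.shiftC (k * η)).Sound f} → σ → ℝ, HasNonnegFactorization N (2 * k₀ + 1) ∧
      (P.shiftC (k * η)).slackMatrix = fun f s => Mt ⟨f.1, f.2⟩ s + N f s := by
  -- the source rows seen from the shifted problem (same soundness predicate)
  let ρ : {f : φ // (P.shiftC (k * η)).Sound f} → {f : φ // P.Sound f} := fun f => ⟨f.1, f.2⟩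
  have h1 : HasNonnegFactorization (fun (f : {f : φ // (P.shiftC (k * η)).Sound f}) (s : σ) =>
      ∑ i, max (a i (ρ f)) 0 * (η - b i s)) k₀ :=
    hasNonnegFactorization_sum (fun i (f : {f : φ // (P.shiftC (k * η)).Sound f}) => max (a i (ρ f)) 0)
      (fun i (s : σ) => η - b i s)
      (fun i f => le_max_right _ _) (fun i s => by linarith [(abs_le.1 (hb i s)).2])
  have h2 : HasNonnegFactorization (fun (f : {f : φ // (P.shiftC (k * η)).Sound f}) (s : σ) =>
      ∑ i, max (-a i (ρ f)) 0 * (η + b i s)) k₀ :=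
    hasNonnegFactorization_sum (fun i (f : {f : φ // (P.shiftC (k * η)).Sound f}) => max (-a i (ρ f)) 0)
      (fun i (s : σ) => η + b i s)
      (fun i f => le_max_right _ _) (fun i s => by linarith [(abs_le.1 (hb i s)).1])
  have hk' : (k₀ : ℝ) ≤ k := by exact_mod_cast hkk
  have h3 : HasNonnegFactorization (fun (f : {f : φ // (P.shiftC (k * η)).Sound f}) (_ : σ) =>
      ∑ _i : Fin 1, ((∑ i, (1 - |a i (ρ f)|)) + ((k : ℝ) - k₀)) * η) 1 :=
    hasNonnegFactorization_sum
      (fun (_ : Fin 1) (f : {f : φ // (P.shiftC (k * η)).Sound f}) => (∑ i, (1 - |a i (ρ f)|)) + ((k : ℝ) - k₀))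
      (fun (_ : Fin 1) (_ : σ) => η)
      (fun _ f => add_nonneg (sum_nonneg fun i _ => by linarith [ha i (ρ f)]) (sub_nonneg.2 hk'))
      (fun _ _ => hη0)
  have hsum := (h1.add h2).add h3
  have hsz : k₀ + k₀ + 1 = 2 * k₀ + 1 := by ring
  rw [hsz] at hsum
  refine ⟨_, hsum, funext fun f => funext fun s => ?_⟩
  rw [MaxProblem.shiftC_slackMatrix]
  change P.slackMatrix (ρ f) s + (k : ℝ) * η = Mt (ρ f) s + _
  have hEfs := hEab (ρ f) s
  simp only [Fin.sum_univ_one]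
  have : P.slackMatrix (ρ f) s + (k : ℝ) * η =
      Mt (ρ f) s + ∑ i : Fin k₀, (η - a i (ρ f) * b i s) + ((k : ℝ) - k₀) * η := by
    rw [sum_sub_distrib, sum_const, card_univ, Fintype.card_fin, nsmul_eq_mul, ← hEfs]; ring
  rw [this]
  simp_rw [shift_sub_mul_eq]
  rw [sum_add_distrib, sum_add_distrib, ← sum_mul]
  ring

/-- **Theorem 7.2, LP clause, in nonnegative-rank currency.**  "Let `𝒫` be an optimization problem with
`(C,S)`-approximate slack matrix `M` and let `M̃` be a nonnegative matrix. Then for the adjusted guarantee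
`C'(f) := C(f) + (rank M + rank M̃)‖M̃ − M‖_∞` [maximization] … `fc(𝒫, C', S) ≤ rk_LP M̃ + 2(rank M + rank M̃)`."
Typed: `M̃` with a nonnegative factorization of size `r`, `‖M̃ − M‖_∞ ≤ η`, any `k ≥ rank(M̃ − M)` (the printed
`k = rank M + rank M̃` qualifies by `rank_sub_slackMatrix_le`); conclusion: the `(C + kη, S)`-slack matrix has a
nonnegative factorization of size `r + 2k + 1` (the tree's `HasNonnegFactorization` has no free affine term, whence `+1`,
cf. `fc_LP ≤ nnr ≤ fc_LP + 1`).  Proof as printed: Lemma 7.1 on `M̃ − M` and the vector identity.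
[cite: BraunPokuttaZink2015, Thm. 7.2 (LP clause) and its proof] -/
theorem BraunPokuttaZink2015_thm72_lp (P : MaxProblem σ φ) (Mt : {f : φ // P.Sound f} → σ → ℝ) {r : ℕ}
    (hMt : HasNonnegFactorization Mt r) {η : ℝ} (hη0 : 0 ≤ η) (hη : ∀ f s, |Mt f s - P.slackMatrix f s| ≤ η)
    {k : ℕ} (hk : (Matrix.of fun f s => Mt f s - P.slackMatrix f s).rank ≤ k) :
    HasNonnegFactorization (P.shiftC (k * η)).slackMatrix (r + (2 * k + 1)) := by
  set E : Matrix {f : φ // P.Sound f} σ ℝ := Matrix.of fun f s => Mt f s - P.slackMatrix f s with hE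
  obtain ⟨k₀, a, b, hk₀, hEab, ha, hb⟩ := BraunPokuttaZink2015_lemma71 E (C := η) (fun f s => hη f s)
  obtain ⟨N, hN, hkey⟩ := correction_terms P Mt hη0 (k₀ := k₀) (k := k) (hk₀ ▸ hk) a b
    (fun f s => by simpa [hE] using hEab f s) ha hb
  rw [hkey]
  exact ((hMt.submatrix (fun f => ⟨f.1, f.2⟩) id).add hN).mono' (by omega : r + (2 * k₀ + 1) ≤ r + (2 * k + 1))

/-- **Theorem 7.2 at formulation level (LP):** an LP formulation of the adjusted problem of size `r + 2k + 1`.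
[cite: BraunPokuttaZink2015, Thm. 7.2 (LP clause)] -/
theorem nonempty_lpFormulation_shiftC (P : MaxProblem σ φ) (Mt : {f : φ // P.Sound f} → σ → ℝ) {r : ℕ}
    (hMt : HasNonnegFactorization Mt r) {η : ℝ} (hη0 : 0 ≤ η) (hη : ∀ f s, |Mt f s - P.slackMatrix f s| ≤ η)
    {k : ℕ} (hk : (Matrix.of fun f s => Mt f s - P.slackMatrix f s).rank ≤ k) :
    Nonempty (LPFormulation (P.shiftC (k * η)) (r + (2 * k + 1))) :=
  LPFormulation.nonempty_of_hasNonnegFactorization (BraunPokuttaZink2015_thm72_lp P Mt hMt hη0 hη hk)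

/-- Nonnegative factorizations are psd factorizations of the same size (diagonal blocks). [cite: FawziEtAl2015, Prop. 2.5 (p05)] -/
private theorem HasNonnegFactorization.hasPsdFactorization' {ι κ : Type*} {M : ι → κ → ℝ} {r : ℕ}
    (h : HasNonnegFactorization M r) : HasPsdFactorization M r := by
  obtain ⟨U, V, hU, hV, hM⟩ := h
  exact HasPsdFactorization.of_nonnegFactorization U V hU hV hM

/-- **Theorem 7.2, SDP clause, in psd-rank currency:** "`fc_SDP(𝒫, C', S) ≤ rk_SDP M̃ + 2(rank M + rank M̃)`" — if `M̃`
has a psd factorization of size `r`, `‖M̃ − M‖_∞ ≤ η` and `rank(M̃ − M) ≤ k`, then the `(C + kη, S)`-slack matrix has a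
psd factorization of size `r + 2k + 1` (the nonnegative rank-one corrections are psd factorizations with diagonal
blocks). [cite: BraunPokuttaZink2015, Thm. 7.2 (SDP clause) and its proof] -/
theorem BraunPokuttaZink2015_thm72_sdp (P : MaxProblem σ φ) (Mt : {f : φ // P.Sound f} → σ → ℝ) {r : ℕ}
    (hMt : HasPsdFactorization Mt r) {η : ℝ} (hη0 : 0 ≤ η) (hη : ∀ f s, |Mt f s - P.slackMatrix f s| ≤ η)
    {k : ℕ} (hk : (Matrix.of fun f s => Mt f s - P.slackMatrix f s).rank ≤ k) :
    HasPsdFactorization (P.shiftC (k * η)).slackMatrix (r + (2 * k + 1)) := by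
  set E : Matrix {f : φ // P.Sound f} σ ℝ := Matrix.of fun f s => Mt f s - P.slackMatrix f s with hE
  obtain ⟨k₀, a, b, hk₀, hEab, ha, hb⟩ := BraunPokuttaZink2015_lemma71 E (C := η) (fun f s => hη f s)
  obtain ⟨N, hN, hkey⟩ := correction_terms P Mt hη0 (k₀ := k₀) (k := k) (hk₀ ▸ hk) a b
    (fun f s => by simpa [hE] using hEab f s) ha hb
  rw [hkey]
  exact ((hMt.submatrix (fun f => ⟨f.1, f.2⟩) id).add (hN.mono' (by omega : 2 * k₀ + 1 ≤ 2 * k + 1)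
    |>.hasPsdFactorization'))

/-- **Theorem 7.2 at formulation level (SDP).** [cite: BraunPokuttaZink2015, Thm. 7.2 (SDP clause)] -/
theorem nonempty_sdpFormulation_shiftC (P : MaxProblem σ φ) (Mt : {f : φ // P.Sound f} → σ → ℝ) {r : ℕ}
    (hMt : HasPsdFactorization Mt r) {η : ℝ} (hη0 : 0 ≤ η) (hη : ∀ f s, |Mt f s - P.slackMatrix f s| ≤ η)
    {k : ℕ} (hk : (Matrix.of fun f s => Mt f s - P.slackMatrix f s).rank ≤ k) :
    Nonempty (SDPFormulation (P.shiftC (k * η)) (r + (2 * k + 1))) :=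
  SDPFormulation.nonempty_of_hasPsdFactorization (BraunPokuttaZink2015_thm72_sdp P Mt hMt hη0 hη hk)

end Thm72

end Literature.Combinatorics.Optimization

end
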